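import Mathlib

/-!
# Tier 3 (T3.2 / T3.5) — characters trivial on a finite-index subgroup are finitely many

Kernel twin of the finiteness sentence in the endgame census of FINDING 2
(proofs/t3-p3/R2-PINNING-ADDENDUM-4.md §A20 (3)): a finite-order anticyclotomic character
`ν ∈ Ξ_𝔭` of the line group `Γ_𝔭` is *unramified* at `𝔓` exactly when it is trivial on the inertia
image `I_𝔓 ⊂ Γ_𝔭`, an open subgroup of finite index; such `ν` factor through the finite group
`Γ_𝔭 / I_𝔓`, and a finite group has only finitely many characters with values in the units of a
domain (each value is a `|G|`-th root of unity).  Hence **all but finitely many** `ν ∈ Ξ_𝔭` have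
conductor exponent `n ≥ 1` at `𝔓` — which is all the cofinite statement of the chain needs
(ADDENDUM-4 §A20 (3)–(6); the «at most `[Γ_𝔭 : I_𝔓]`» count is the `card` bound below).

Everything is abstract: `Γ` a commutative group, `U` a subgroup of finite index (the inertia
image), characters `Γ →* Rˣ` for a domain `R` (`ℂ`, `ℚ̄`, `𝓞_{ℂ_p}`, …).  Nothing here is about
Hecke characters, conductors or class field theory — those identifications stay on paper.

`import Mathlib` only; theorems only (no definition, no instance); no axiom beyond the standard
three.
-/

namespace Summit.Ventures.HodgeRepro.T3.UnramifiedCofinite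

open Subgroup

section FiniteGroup

variable (G : Type*) [Group G] [Finite G] (R : Type*) [CommRing R] [IsDomain R]

omit [Finite G] [IsDomain R] in
/-- The value of a character of a finite group `G` at any element is a `Nat.card G`-th root of
unity (Lagrange: `g ^ |G| = 1`). -/
theorem apply_mem_rootsOfUnity (χ : G →* Rˣ) (g : G) :
    χ g ∈ rootsOfUnity (Nat.card G) R := by
  rw [mem_rootsOfUnity, ← map_pow, pow_card_eq_one', map_one]

omit [Finite G] [IsDomain R] in
/-- A character of a finite group is determined by its values in the `|G|`-th roots of unity:
the map `χ ↦ (g ↦ ⟨χ g, _⟩)` into `G → rootsOfUnity (Nat.card G) R` is injective. -/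
theorem toRoots_injective :
    Function.Injective (fun χ : G →* Rˣ => fun g : G =>
      (⟨χ g, apply_mem_rootsOfUnity G R χ g⟩ : rootsOfUnity (Nat.card G) R)) := by
  intro χ₁ χ₂ h
  refine MonoidHom.ext fun g => ?_
  have hg := congrFun h g
  simpa [Subtype.ext_iff] using hg

/-- **Finiteness**: a finite group has only finitely many characters with values in the units
of a domain (each value is a `|G|`-th root of unity, and there are finitely many of those).
Stated as a theorem, not an instance, so that the file stays of kind `proof`. -/
theorem finite_monoidHom_units : Finite (G →* Rˣ) := by
  haveI : NeZero (Nat.card G) := ⟨Nat.card_pos.ne'⟩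
  exact Finite.of_injective _ (toRoots_injective G R)

end FiniteGroup

section FiniteIndex

variable {Γ : Type*} [CommGroup Γ] (U : Subgroup Γ) [U.FiniteIndex]
  (R : Type*) [CommRing R] [IsDomain R]

omit [U.FiniteIndex] [IsDomain R] in
/-- A character of `Γ` trivial on `U` descends to the finite quotient `Γ ⧸ U`
(`QuotientGroup.lift`; `U` is normal since `Γ` is commutative), and the descent is injective on
the characters trivial on `U`: the character is recovered by composing with the projection. -/
theorem lift_injective :
    Function.Injective (fun ν : {ν : Γ →* Rˣ // U ≤ ν.ker} =>
      QuotientGroup.lift U ν.1 ν.2) := by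
  intro ν₁ ν₂ h
  refine Subtype.ext (MonoidHom.ext fun g => ?_)
  have hg := congrArg (fun φ : Γ ⧸ U →* Rˣ => φ (g : Γ ⧸ U)) h
  simpa using hg

/-- **The characters of `Γ` trivial on a finite-index subgroup `U` form a finite type**
(they are the characters of the finite group `Γ ⧸ U`). -/
theorem finite_subtype_le_ker : Finite {ν : Γ →* Rˣ // U ≤ ν.ker} := by
  haveI := finite_monoidHom_units (Γ ⧸ U) R
  exact Finite.of_injective _ (lift_injective U R)

/-- The same, as a finite set: `{ν : Γ →* Rˣ | U ≤ ν.ker}` is finite. -/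
theorem finite_setOf_le_ker : {ν : Γ →* Rˣ | U ≤ ν.ker}.Finite :=
  Set.finite_coe_iff.mp (finite_subtype_le_ker U R)

/-- **Counting**: there are at most as many characters of `Γ` trivial on `U` as characters of
the finite quotient `Γ ⧸ U` (the «at most `[Γ_𝔭 : I_𝔓]`» bound of ADDENDUM-4 §A20 (3) once the
characters of a finite abelian group are counted). -/
theorem card_le_ker_le : Nat.card {ν : Γ →* Rˣ // U ≤ ν.ker} ≤ Nat.card (Γ ⧸ U →* Rˣ) :=
  Nat.card_le_card_of_injective _ (lift_injective U R)

/-- **Cofinite form**: all but finitely many characters of `Γ` are non-trivial on `U`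
(«all but finitely many `ν ∈ Ξ_𝔭` are ramified at `𝔓`»). -/
theorem eventually_cofinite_not_le_ker :
    ∀ᶠ ν : Γ →* Rˣ in Filter.cofinite, ¬ U ≤ ν.ker := by
  rw [Filter.eventually_cofinite]
  simpa using finite_setOf_le_ker U R

/-- **Existence form**: for all but finitely many characters `ν` of `Γ` there is `u ∈ U` with
`ν u ≠ 1` (a non-trivial value on the inertia image = conductor exponent `≥ 1`). -/
theorem eventually_cofinite_exists_ne_one :
    ∀ᶠ ν : Γ →* Rˣ in Filter.cofinite, ∃ u ∈ U, ν u ≠ 1 := by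
  filter_upwards [eventually_cofinite_not_le_ker U R] with ν hν
  by_contra h
  exact hν fun u hu => by
    rw [MonoidHom.mem_ker]
    by_contra hne
    exact h ⟨u, hu, hne⟩

/-- **Inside any family `Ξ` of characters** (e.g. the finite-order ones, `Ξ_𝔭`), the members
trivial on `U` are finitely many. -/
theorem finite_inter_le_ker (Ξ : Set (Γ →* Rˣ)) : {ν ∈ Ξ | U ≤ ν.ker}.Finite :=
  (finite_setOf_le_ker U R).subset fun _ hν => hν.2

/-- **The chain's shape**: the members of `Ξ` that are NOT ramified on `U` (no `u ∈ U` with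
`ν u ≠ 1`) form a finite set — so «for all but finitely many `ν ∈ Ξ`, `ν` is ramified». -/
theorem finite_diff_ramified (Ξ : Set (Γ →* Rˣ)) :
    (Ξ \ {ν | ∃ u ∈ U, ν u ≠ 1}).Finite := by
  refine (finite_inter_le_ker U R Ξ).subset ?_
  rintro ν ⟨hΞ, hν⟩
  refine ⟨hΞ, fun u hu => ?_⟩
  rw [MonoidHom.mem_ker]
  by_contra h
  exact hν ⟨u, hu, h⟩

/-- An infinite family `Ξ` of characters contains infinitely many that are ramified on `U`. -/
theorem infinite_ramified (Ξ : Set (Γ →* Rˣ)) (hΞ : Ξ.Infinite) :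
    {ν ∈ Ξ | ∃ u ∈ U, ν u ≠ 1}.Infinite := by
  intro hfin
  apply hΞ
  have : Ξ ⊆ {ν ∈ Ξ | ∃ u ∈ U, ν u ≠ 1} ∪ (Ξ \ {ν | ∃ u ∈ U, ν u ≠ 1}) := by
    intro ν hν
    by_cases h : ∃ u ∈ U, ν u ≠ 1
    · exact Or.inl ⟨hν, h⟩
    · exact Or.inr ⟨hν, h⟩
  exact (hfin.union (finite_diff_ramified U R Ξ)).subset this

end FiniteIndex

section Padic

/-! ### The line `Γ_𝔭 ≅ ℤ_p` (deg 𝔭 = 1): the open subgroups `pⁿℤ_p` have finite index, so the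
abstract statements apply verbatim with `Γ := Multiplicative ℤ_p` and `U := pⁿℤ_p`. -/

variable (p : ℕ) [Fact p.Prime] (R : Type*) [CommRing R] [IsDomain R]

/-- `ℤ_p ⧸ pⁿℤ_p ≅ ℤ/pⁿℤ` is finite (`PadicInt.toZModPow n` is onto with kernel `(pⁿ)`;
the same fact as `Tier3TorsionSplit.finite_quotient_span_pow`, re-proved here to keep this file
on `import Mathlib` alone). -/
theorem finite_padicInt_quotient_span_pow (n : ℕ) :
    Finite (ℤ_[p] ⧸ Ideal.span {(p : ℤ_[p]) ^ n}) := by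
  have e : (ℤ_[p] ⧸ Ideal.span {(p : ℤ_[p]) ^ n}) ≃+* ZMod (p ^ n) :=
    (Ideal.quotEquivOfEq (PadicInt.ker_toZModPow n).symm).trans
      (RingHom.quotientKerEquivOfSurjective (ZMod.ringHom_surjective (PadicInt.toZModPow n)))
  exact Finite.of_equiv _ e.symm.toEquiv

/-- The additive subgroup `pⁿℤ_p ⊂ ℤ_p` has finite index (= `pⁿ`). -/
theorem finiteIndex_span_pow_toAddSubgroup (n : ℕ) :
    (Ideal.span {(p : ℤ_[p]) ^ n}).toAddSubgroup.FiniteIndex := by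
  haveI : Finite (ℤ_[p] ⧸ (Ideal.span {(p : ℤ_[p]) ^ n}).toAddSubgroup) :=
    finite_padicInt_quotient_span_pow p n
  exact AddSubgroup.finiteIndex_of_finite_quotient

/-- `pⁿℤ_p` as a subgroup of the multiplicative line `Multiplicative ℤ_p`, of finite index. -/
theorem finiteIndex_line_span_pow (n : ℕ) :
    ((Ideal.span {(p : ℤ_[p]) ^ n}).toAddSubgroup.toSubgroup).FiniteIndex :=
  (AddSubgroup.finiteIndex_toSubgroup_iff _).mpr (finiteIndex_span_pow_toAddSubgroup p n)

/-- **On the line `Γ_𝔭 ≅ ℤ_p`**: for every `n`, all but finitely many characters `ν` of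
`Multiplicative ℤ_p` (values in the units of a domain) take a value `≠ 1` somewhere on the open
subgroup `pⁿℤ_p` — «all but finitely many `ν` are non-trivial on the inertia image», the
finiteness sentence of ADDENDUM-4 §A20 (3) with `I_𝔓 = pⁿℤ_p`. -/
theorem padicInt_eventually_cofinite_exists_ne_one (n : ℕ) :
    ∀ᶠ ν : Multiplicative ℤ_[p] →* Rˣ in Filter.cofinite,
      ∃ x : ℤ_[p], ν (Multiplicative.ofAdd ((p : ℤ_[p]) ^ n * x)) ≠ 1 := by
  haveI := finiteIndex_line_span_pow p n
  filter_upwards [eventually_cofinite_exists_ne_one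
    ((Ideal.span {(p : ℤ_[p]) ^ n}).toAddSubgroup.toSubgroup) R] with ν hν
  obtain ⟨u, hu, hne⟩ := hν
  rw [Multiplicative.mem_toSubgroup, Submodule.mem_toAddSubgroup,
    Ideal.mem_span_singleton'] at hu
  obtain ⟨x, hx⟩ := hu
  refine ⟨x, ?_⟩
  have hu' : Multiplicative.ofAdd ((p : ℤ_[p]) ^ n * x) = u := by
    rw [mul_comm, hx, ofAdd_toAdd]
  rw [hu']
  exact hne

/-- The same for the finite-order characters (or any family `Ξ`) of the line: those trivial on
`pⁿℤ_p` are finitely many. -/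
theorem padicInt_finite_inter_le_ker (n : ℕ) (Ξ : Set (Multiplicative ℤ_[p] →* Rˣ)) :
    {ν ∈ Ξ | (Ideal.span {(p : ℤ_[p]) ^ n}).toAddSubgroup.toSubgroup ≤ ν.ker}.Finite := by
  haveI := finiteIndex_line_span_pow p n
  exact finite_inter_le_ker _ R Ξ

end Padic

end Summit.Ventures.HodgeRepro.T3.UnramifiedCofinite

/-!
## v2 appendix (t3-p3 g6): the EXACT count over `ℂ`, and open subgroups of `ℤ_p`

* Over `ℂ` a finite commutative group `G` has EXACTLY `|G|` characters (Mathlib's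
  `AddChar.card_eq`, transported to `G →* ℂˣ`), so the characters of `Γ` trivial on a finite-index
  `U` are EXACTLY `[Γ : U]` many — the «at most `[Γ_𝔭 : I_𝔓]`» count of ADDENDUM-4 §A20 (3) is
  sharp; on the line `ℤ_p` with `U = pⁿℤ_p` the count is `pⁿ`.
* An OPEN subgroup of the compact group `ℤ_p` has finite index (Mathlib's
  `quotient_finite_of_isOpen`), so the cofinite statements apply to the inertia image `I_𝔓`
  as the page gives it — an open subgroup — without choosing the `n` of `pⁿℤ_p`.
-/

namespace Summit.Ventures.HodgeRepro.T3.UnramifiedCofinite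

section ExactCountComplex

/-- Over `ℂ`, a finite commutative group has EXACTLY `Nat.card G` characters `G →* ℂˣ`
(Mathlib's `AddChar.card_eq` for `AddChar (Additive G) ℂ`, transported along
`AddChar.toMonoidHomEquiv`, `MulEquiv.multiplicativeAdditive` and `MonoidHom.toHomUnitsMulEquiv`). -/
theorem nat_card_monoidHom_units_complex (G : Type*) [CommGroup G] [Finite G] :
    Nat.card (G →* ℂˣ) = Nat.card G := by
  classical
  haveI : Fintype (Additive G) := Fintype.ofFinite _
  -- `G →* ℂˣ` ≃ `G →* ℂ` ≃ `Multiplicative (Additive G) →* ℂ` ≃ `AddChar (Additive G) ℂ`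
  have e₁ : (G →* ℂˣ) ≃ (G →* ℂ) := (MonoidHom.toHomUnitsMulEquiv (G := G) (M := ℂ)).toEquiv.symm
  have e₂ : (G →* ℂ) ≃ (Multiplicative (Additive G) →* ℂ) :=
    MulEquiv.monoidHomCongrLeftEquiv (MulEquiv.multiplicativeAdditive G).symm
  have e₃ : (Multiplicative (Additive G) →* ℂ) ≃ AddChar (Additive G) ℂ :=
    AddChar.toMonoidHomEquiv.symm
  rw [Nat.card_congr ((e₁.trans e₂).trans e₃), Nat.card_eq_fintype_card, AddChar.card_eq,
    ← Nat.card_eq_fintype_card]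
  rfl

variable {Γ : Type*} [CommGroup Γ] (U : Subgroup Γ) [U.FiniteIndex]

omit [U.FiniteIndex] in
/-- Composition with the projection `Γ → Γ ⧸ U` is injective from the characters of the quotient
into the characters of `Γ` trivial on `U` (the inverse direction of `lift_injective`). -/
theorem comp_mk'_injective (R : Type*) [CommRing R] [IsDomain R] :
    Function.Injective (fun φ : Γ ⧸ U →* Rˣ =>
      (⟨φ.comp (QuotientGroup.mk' U), fun u hu => by
        rw [MonoidHom.mem_ker, MonoidHom.comp_apply, QuotientGroup.mk'_apply,
          (QuotientGroup.eq_one_iff u).mpr hu, map_one]⟩ : {ν : Γ →* Rˣ // U ≤ ν.ker})) := by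
  intro φ₁ φ₂ h
  have h' := congrArg Subtype.val h
  exact (MonoidHom.cancel_right (QuotientGroup.mk'_surjective U)).mp h'

/-- **The exact count over `ℂ`**: the characters `Γ →* ℂˣ` trivial on a finite-index subgroup
`U` are EXACTLY `[Γ : U]` many — they are the characters of the finite quotient `Γ ⧸ U`. -/
theorem nat_card_le_ker_eq_index :
    Nat.card {ν : Γ →* ℂˣ // U ≤ ν.ker} = U.index := by
  haveI hfin := finite_subtype_le_ker U ℂ
  haveI := finite_monoidHom_units (Γ ⧸ U) ℂ
  apply le_antisymm
  · calc Nat.card {ν : Γ →* ℂˣ // U ≤ ν.ker}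
        ≤ Nat.card (Γ ⧸ U →* ℂˣ) := card_le_ker_le U ℂ
      _ = Nat.card (Γ ⧸ U) := nat_card_monoidHom_units_complex (Γ ⧸ U)
      _ = U.index := U.index_eq_card.symm
  · calc U.index = Nat.card (Γ ⧸ U) := U.index_eq_card
      _ = Nat.card (Γ ⧸ U →* ℂˣ) := (nat_card_monoidHom_units_complex (Γ ⧸ U)).symm
      _ ≤ Nat.card {ν : Γ →* ℂˣ // U ≤ ν.ker} :=
          Nat.card_le_card_of_injective _ (comp_mk'_injective U ℂ)

end ExactCountComplex

section PadicOpen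

variable (p : ℕ) [Fact p.Prime] (R : Type*) [CommRing R] [IsDomain R]

/-- An OPEN additive subgroup of the compact group `ℤ_p` has finite index
(Mathlib: `AddSubgroup.quotient_finite_of_isOpen`). -/
theorem finiteIndex_of_isOpen (U : AddSubgroup ℤ_[p]) (hU : IsOpen (U : Set ℤ_[p])) :
    U.FiniteIndex := by
  haveI : Finite (ℤ_[p] ⧸ U) := AddSubgroup.quotient_finite_of_isOpen U hU
  exact AddSubgroup.finiteIndex_of_finite_quotient

/-- **On the line `Γ_𝔭 ≅ ℤ_p`, for ANY open subgroup `U` (the inertia image `I_𝔓` as the page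
gives it)**: all but finitely many characters of `Multiplicative ℤ_p` are non-trivial on `U`. -/
theorem padicInt_eventually_cofinite_exists_ne_one_of_isOpen (U : AddSubgroup ℤ_[p])
    (hU : IsOpen (U : Set ℤ_[p])) :
    ∀ᶠ ν : Multiplicative ℤ_[p] →* Rˣ in Filter.cofinite,
      ∃ u ∈ U, ν (Multiplicative.ofAdd u) ≠ 1 := by
  haveI : U.toSubgroup.FiniteIndex :=
    (AddSubgroup.finiteIndex_toSubgroup_iff U).mpr (finiteIndex_of_isOpen p U hU)
  filter_upwards [eventually_cofinite_exists_ne_one U.toSubgroup R] with ν hν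
  obtain ⟨u, hu, hne⟩ := hν
  exact ⟨Multiplicative.toAdd u, hu, hne⟩

/-- The same, inside any family `Ξ` of characters of the line: the members trivial on an open
subgroup are finitely many. -/
theorem padicInt_finite_inter_le_ker_of_isOpen (U : AddSubgroup ℤ_[p])
    (hU : IsOpen (U : Set ℤ_[p])) (Ξ : Set (Multiplicative ℤ_[p] →* Rˣ)) :
    {ν ∈ Ξ | U.toSubgroup ≤ ν.ker}.Finite := by
  haveI : U.toSubgroup.FiniteIndex :=
    (AddSubgroup.finiteIndex_toSubgroup_iff U).mpr (finiteIndex_of_isOpen p U hU)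
  exact finite_inter_le_ker U.toSubgroup R Ξ

/-- The index of `pⁿℤ_p` in `ℤ_p` is `pⁿ` (`ℤ_p ⧸ pⁿℤ_p ≅ ℤ/pⁿℤ`). -/
theorem index_span_pow_toAddSubgroup (n : ℕ) :
    (Ideal.span {(p : ℤ_[p]) ^ n}).toAddSubgroup.index = p ^ n := by
  have e : (ℤ_[p] ⧸ Ideal.span {(p : ℤ_[p]) ^ n}) ≃+* ZMod (p ^ n) :=
    (Ideal.quotEquivOfEq (PadicInt.ker_toZModPow n).symm).trans
      (RingHom.quotientKerEquivOfSurjective (ZMod.ringHom_surjective (PadicInt.toZModPow n)))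
  rw [AddSubgroup.index_eq_card]
  exact (Nat.card_congr e.toEquiv).trans (Nat.card_zmod (p ^ n))

/-- **Exactly `pⁿ` characters of the line `ℤ_p` (over `ℂ`) are trivial on `pⁿℤ_p`** — the sharp
form of «at most `[Γ_𝔭 : I_𝔓]` characters `ν ∈ Ξ_𝔭` have conductor exponent `0`» (ADDENDUM-4
§A20 (3)) when `I_𝔓 = pⁿℤ_p`. -/
theorem nat_card_padicInt_le_ker_span_pow (n : ℕ) :
    Nat.card {ν : Multiplicative ℤ_[p] →* ℂˣ //
      (Ideal.span {(p : ℤ_[p]) ^ n}).toAddSubgroup.toSubgroup ≤ ν.ker} = p ^ n := by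
  haveI := finiteIndex_line_span_pow p n
  rw [nat_card_le_ker_eq_index, AddSubgroup.index_toSubgroup, index_span_pow_toAddSubgroup]

end PadicOpen

end Summit.Ventures.HodgeRepro.T3.UnramifiedCofinite
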